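import Summits.AtomisticToContinuum.HydrodynamicLimit.Theorems.JParityClosureOddContactSymmetryGibbsInvariance
import HarnessLib

/-!
# Excess Markov over windows at rung 0: an UPPER tail for a window sum from a one-window second moment
# (helper file, `--supports stmt-AtomisticToContinuum-13080`)

Crux `JParityClosure.RateFloor` (stmt-AtomisticToContinuum-13080), line `last-flight-poissonization`, stub KO `stub_knockOutSmall`
(knock-outs are a small fraction) at rung 0.  KO is an UPPER bound in probability whose confidence `δ` is quantified AFTER the
reduced density `σ`, so a first moment (Markov on the mean, `stub_markovFlowTransferRung0`) cannot reach it: one needs the window sum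
`Σ_k Y(Φ_{t_k} z)` of a nonnegative static functional `Y` (the one-window knock-out count) to stay below a multiple of its mean
`K μ` up to `η`, with probability `→ 1`.  The device recorded here is the upper-tail twin of
`RateFloorMarkovWindows.measure_le_card_windows_mem_le`: for constant profiles `G_N` is `Φ_t`-invariant
(`lintegral_comp_flow_localGibbsLaw_const`), so for a measurable `Y`, window starts `t : Fin K → ℝ`, a level `μ > 0` and `η > 0`,

  `G_N {z | 2Kμ + η ≤ Σ_k Y(Φ_{t_k} z)} ≤ K · ∫ (Y − μ)² dG_N / (μ η)`     (`measure_le_sum_windows_le`),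

from the pointwise inequalities `y ≤ 2μ + (y − μ)²/μ` (`le_two_mul_add_sq_div`) summed over the windows, invariance at each `t_k`,
and Markov.  With `μ = E Y` the right-hand side is `(Kμ) · (Var Y/μ²) / η` = (total mean) × (one-window RELATIVE variance) / `η`,
which tends to `0` whenever the one-window relative variance does, with the total mean bounded — no union bound, no two-time input.
Elementary; recorded here.  prover-line-stmt-AtomisticToContinuum-13080-a3-0 (wave-1 worker KO).
-/

noncomputable section

open MeasureTheory ProbabilityTheory Set Filter Topology
open scoped ENNReal BigOperators

namespace Summit.AtomisticToContinuum.HydrodynamicLimit.Theorems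

namespace RateFloorWindowExcessMarkov

open Literature.Analysis.FluidPDE Literature.MathematicalPhysics.KineticTheory

/-- The pointwise lever: for `μ > 0` and every real `y`, `y ≤ 2μ + (y − μ)²/μ` (if `y ≥ 2μ` then `y − μ ≥ μ`, so
`(y − 2μ)μ ≤ (y − μ)μ ≤ (y − μ)²`; if `y < 2μ` the square is `≥ 0`). [folklore] -/
theorem le_two_mul_add_sq_div {y μ : ℝ} (hμ : 0 < μ) : y ≤ 2 * μ + (y - μ) ^ 2 / μ := by
  have hsq : 0 ≤ (y - μ) ^ 2 / μ := by positivity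
  by_cases h : y ≤ 2 * μ
  · linarith
  · have h' : 2 * μ < y := lt_of_not_ge h
    have h1 : (y - 2 * μ) * μ ≤ (y - μ) ^ 2 := by nlinarith
    have h2 : y - 2 * μ ≤ (y - μ) ^ 2 / μ := by
      rw [le_div_iff₀ hμ]
      exact h1
    linarith

/-- Summed over `K` windows: `Σ_k y_k ≤ 2Kμ + Σ_k (y_k − μ)²/μ`. [folklore] -/
theorem sum_le_two_mul_add_sum_sq_div {K : ℕ} (y : Fin K → ℝ) {μ : ℝ} (hμ : 0 < μ) :
    ∑ k, y k ≤ 2 * K * μ + ∑ k, (y k - μ) ^ 2 / μ := by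
  calc ∑ k, y k ≤ ∑ _k : Fin K, (2 * μ) + ∑ k, (y k - μ) ^ 2 / μ := by
        rw [← Finset.sum_add_distrib]
        exact Finset.sum_le_sum fun k _ => le_two_mul_add_sq_div hμ
    _ = 2 * K * μ + ∑ k, (y k - μ) ^ 2 / μ := by
        rw [Finset.sum_const, Finset.card_univ, Fintype.card_fin, nsmul_eq_mul]
        ring

/-- **Excess Markov over windows at rung 0.**  Constant profiles, a flow `Φ`, a measurable static functional `Y`, window start
times `t : Fin K → ℝ`, a level `0 < μ` and a slack `0 < η`:
`G_N {z | 2Kμ + η ≤ Σ_k Y(Φ_{t_k} z)} ≤ (K · ∫⁻ ofReal ((Y − μ)²) dG_N) / ofReal (μ η)`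
(pointwise `Σ y_k ≤ 2Kμ + Σ (y_k − μ)²/μ`; the expected sum of squares is `K ∫ (Y − μ)²` by invariance; Markov). [folklore] -/
theorem measure_le_sum_windows_le (σ a θ : ℝ) (u : V3) (N : ℕ)
    (Φ : HardSphereFlow (Torus.geometry (Fin 3)) (hsDiameter σ N) (N + 1)) {Y : Config (N + 1) (Fin 3) T3 → ℝ}
    (hY : Measurable Y) {K : ℕ} (t : Fin K → ℝ) {μ η : ℝ} (hμ : 0 < μ) (hη : 0 < η) :
    localGibbsLaw σ (fun _ => a) (fun _ => u) (fun _ => θ) N Φ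
        {z | 2 * K * μ + η ≤ ∑ k : Fin K, Y (Φ.flow (t k) z)} ≤
      ((K : ℝ≥0∞) * ∫⁻ z, ENNReal.ofReal ((Y z - μ) ^ 2)
          ∂(localGibbsLaw σ (fun _ => a) (fun _ => u) (fun _ => θ) N Φ)) / ENNReal.ofReal (μ * η) := by
  set G := localGibbsLaw σ (fun _ => a) (fun _ => u) (fun _ => θ) N Φ with hG
  -- the squared-deviation functional and its window sum
  have hgm : Measurable fun z : Config (N + 1) (Fin 3) T3 => ENNReal.ofReal ((Y z - μ) ^ 2) :=
    ((hY.sub_const μ).pow_const 2).ennreal_ofReal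
  set F : Config (N + 1) (Fin 3) T3 → ℝ≥0∞ := fun z => ∑ k : Fin K, ENNReal.ofReal ((Y (Φ.flow (t k) z) - μ) ^ 2)
    with hF
  have hFm : Measurable F := by
    refine Finset.measurable_sum _ fun k _ => ?_
    exact hgm.comp (Φ.measurable_flow (t k))
  -- (1) the event is contained in `{ofReal (μ η) ≤ F}`
  have hsub : {z | 2 * K * μ + η ≤ ∑ k : Fin K, Y (Φ.flow (t k) z)} ⊆ {z | ENNReal.ofReal (μ * η) ≤ F z} := by
    intro z hz
    simp only [mem_setOf_eq] at hz ⊢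
    have h1 := sum_le_two_mul_add_sum_sq_div (fun k => Y (Φ.flow (t k) z)) hμ
    have h2 : η ≤ ∑ k, (Y (Φ.flow (t k) z) - μ) ^ 2 / μ := by linarith
    have h3 : μ * η ≤ ∑ k, (Y (Φ.flow (t k) z) - μ) ^ 2 := by
      have h4 := mul_le_mul_of_nonneg_left h2 hμ.le
      rw [Finset.mul_sum] at h4
      refine h4.trans (le_of_eq (Finset.sum_congr rfl fun k _ => ?_))
      field_simp
    show ENNReal.ofReal (μ * η) ≤ ∑ k : Fin K, ENNReal.ofReal ((Y (Φ.flow (t k) z) - μ) ^ 2)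
    rw [← ENNReal.ofReal_sum_of_nonneg (fun k _ => sq_nonneg _)]
    exact ENNReal.ofReal_le_ofReal h3
  -- (2) invariance: `∫⁻ F = K · ∫⁻ ofReal ((Y − μ)²)`
  have hint : ∫⁻ z, F z ∂G = (K : ℝ≥0∞) * ∫⁻ z, ENNReal.ofReal ((Y z - μ) ^ 2) ∂G := by
    show ∫⁻ z, ∑ k : Fin K, ENNReal.ofReal ((Y (Φ.flow (t k) z) - μ) ^ 2) ∂G = _
    rw [lintegral_finsetSum Finset.univ (f := fun k z => ENNReal.ofReal ((Y (Φ.flow (t k) z) - μ) ^ 2))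
      (fun k _ => hgm.comp (Φ.measurable_flow (t k)))]
    have hk : ∀ k : Fin K, ∫⁻ z, ENNReal.ofReal ((Y (Φ.flow (t k) z) - μ) ^ 2) ∂G =
        ∫⁻ z, ENNReal.ofReal ((Y z - μ) ^ 2) ∂G := fun k =>
      lintegral_comp_flow_localGibbsLaw_const σ a θ u N Φ (t k) hgm
    simp only [hk, Finset.sum_const, Finset.card_univ, Fintype.card_fin, nsmul_eq_mul]
  -- (3) Markov
  have hc : ENNReal.ofReal (μ * η) ≠ 0 := (ENNReal.ofReal_pos.2 (mul_pos hμ hη)).ne'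
  calc G {z | 2 * K * μ + η ≤ ∑ k : Fin K, Y (Φ.flow (t k) z)}
      ≤ G {z | ENNReal.ofReal (μ * η) ≤ F z} := measure_mono hsub
    _ ≤ (∫⁻ z, F z ∂G) / ENNReal.ofReal (μ * η) := meas_ge_le_lintegral_div hFm.aemeasurable hc ENNReal.ofReal_ne_top
    _ = ((K : ℝ≥0∞) * ∫⁻ z, ENNReal.ofReal ((Y z - μ) ^ 2) ∂G) / ENNReal.ofReal (μ * η) := by rw [hint]

/-- **Registered helper stub `stub_windowExcessMarkovRung0`** of crux stmt-AtomisticToContinuum-13080 (line `last-flight-poissonization`,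
rung-0 input of `stub_knockOutSmall`): the excess Markov transfer over windows at rung 0, in closed signature form
(= `measure_le_sum_windows_le`). [folklore] -/
theorem stub_windowExcessMarkovRung0 : ∀ (σ a θ : ℝ) (u : V3) (N : ℕ) (Φ : HardSphereFlow (Torus.geometry (Fin 3)) (hsDiameter σ N) (N + 1)) (Y : Config (N + 1) (Fin 3) T3 → ℝ), Measurable Y → ∀ (K : ℕ) (t : Fin K → ℝ) (μ η : ℝ), 0 < μ → 0 < η → localGibbsLaw σ (fun _ => a) (fun _ => u) (fun _ => θ) N Φ {z | 2 * K * μ + η ≤ ∑ k : Fin K, Y (Φ.flow (t k) z)} ≤ ((K : ENNReal) * ∫⁻ z, ENNReal.ofReal ((Y z - μ) ^ 2) ∂(localGibbsLaw σ (fun _ => a) (fun _ => u) (fun _ => θ) N Φ)) / ENNReal.ofReal (μ * η) :=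
  fun σ a θ u N Φ _Y hY _K t _μ _η hμ hη => measure_le_sum_windows_le σ a θ u N Φ hY t hμ hη

end RateFloorWindowExcessMarkov

end Summit.AtomisticToContinuum.HydrodynamicLimit.Theorems

end
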